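import Literature.NumberTheory.Automorphic.UnitaryGroupAutomorphicRep
import Summits.HodgeConjecture.HodgeConjecture.Theorems.K2LiuDoublingLagrangianIsGraph
import Summits.HodgeConjecture.HodgeConjecture.Theorems.K2LiuHermitianWittTransitive

/-!
# K2_Liu_CurveThetaSigs — unit U3b «DOUBLING» (tier-1 socket module for hLiu418 = stmt-HodgeConjecture-24832)

Track B ∕ build stream 29 (`Cruxes/HLiu418/Lines/K2_Liu_*`). Planner `hodgecm-mathlib-K2Liu-plan` g0,
2026-09-03. INFO-ONLY companion to the #184♮ LINE `Cruxes/HLiu418/Lines/K2_Liu_CurveThetaNonOrthogonal.lean`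
(A-plan2 (g33)). Sockets of unit U3b (Liu 2021 §B.3, generalized doubling: `V^◇ = V ⊕ (−V)`,
`V^± = {(v, ±v)}`, `P_a = Stab(V_a^+)`, Lem. B.10–B.12) that are typeable over Mathlib carriers
before the DEFS leaf D4 `K2Lit/GlobalDoublingEmbedding` lands — see
`K2/K2Liu-plan/g0/DEPMAP-PRICE-184nat.v1.K2Liu-plan-g0.md` (b9277aeddb85c718) §4 file #12.
One `theorem sig_<File> : ‹statement› := by sorry` per planned file; no `def`/`instance`/`notation`.
HONEST LABEL: HC_CM is proved only modulo the 7 printed citations (2 remaining named inputs: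
hLiu418 = stmt-HodgeConjecture-24832, h413 = stmt-HodgeConjecture-24833) until rung 0 closes.

ED. 3 (2026-09-03, re-tie edition, LEAD F0P6-plan (g10) 20:45:16Z «batch #12₀ + #12₁ in one edition»): both sockets of this unit are
PAID — statement bytes UNCHANGED, the `sorry` bodies replaced BY NAME by the landed theorems ★ p854707
`Theorems/K2LiuDoublingLagrangianIsGraph.lean` (K2Liu-p03 (g0)) and ★ p854727 `Theorems/K2LiuHermitianWittTransitive.lean` (K2Liu-p04 (g0));
the module is now sorry-free (the by-name terms ARE the tie probes: they elaborate iff the landed types equal the socket bytes).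
-/

open scoped Matrix

namespace Summit.HodgeConjecture.HodgeConjecture.Cruxes.HLiu418.K2LiuCurveThetaSigsU3bDoubling

/-- socket #12₀ (U3b, the `a = 0` orbit lemma of the doubling method for an ANISOTROPIC space) —
**every Lagrangian of the doubled space `V ⊕ (−V)` is the graph of an isometry of `V`**: let `L` be a
field with an endomorphism `c` (the CM conjugation in the application), `H` an `n × n` matrix whose
`c`-sesquilinear form `B(x, y) = Σ c(x_i) H_{ij} y_j` is anisotropic (`B(x, x) ≠ 0` for `x ≠ 0`). If
`U ≤ V × V` (`V = L^n`) is totally isotropic for `B ⊕ (−B)` and `dim U = n`, then `U = graph φ` for an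
`L`-linear `φ : V → V` preserving `B`. Consequently `U(V)(F) × U(V)(F)` acts transitively on
`P \ U(V^◇)(F)` (with Witt's theorem): at `a = 0` the doubling integral (B.4)/Lem. B.11 has NO
negligible orbits for the anisotropic `V` of the letter (`d ≥ 2`, `H` definite at a real place).
[cite: Liu2021, §B.3 (B.4) & Lem. B.11, p. 101–102] [cite: PiatetskiShapiroRallis1987, §2]
audit: paper:liu2021-fourier-jacobi-cycles-arithmetic-relative-trace-formula p0101.txt:L23 «Put V± := {(v, ±v) ∈ V | v ∈ V} and Va± := V± ⊕ δa± . Let Pa be the parabolic subgroup of U(Va ) stabilizing»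
size M · deps: Mathlib only (`LinearMap.graph`, `Submodule`, `Module.finrank`, `dotProduct`, `Matrix.mulVec`);
consumed by file #12 `K2LiuDoublingOrbits` / #13 `K2LiuDoublingUnfolding` at `a = 0` (road S-B; S-A uses the
isotropic `V_a`, `a ≥ 2`, general orbit lemma — a later socket over D4) · OWNER: open. -/
theorem sig_K2LiuDoublingLagrangianIsGraph :
    ∀ (L : Type) [Field L] (c : L →+* L) (n : ℕ) (H : Matrix (Fin n) (Fin n) L),
      (∀ x : Fin n → L, x ≠ 0 → dotProduct (fun i => c (x i)) (H.mulVec x) ≠ 0) →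
        ∀ U : Submodule L ((Fin n → L) × (Fin n → L)),
          (∀ u ∈ U, ∀ v ∈ U,
              dotProduct (fun i => c (u.1 i)) (H.mulVec v.1) = dotProduct (fun i => c (u.2 i)) (H.mulVec v.2)) →
            Module.finrank L U = n →
              ∃ φ : (Fin n → L) →ₗ[L] (Fin n → L),
                (∀ x y : Fin n → L,
                    dotProduct (fun i => c (φ x i)) (H.mulVec (φ y)) = dotProduct (fun i => c (x i)) (H.mulVec y)) ∧
                  U = LinearMap.graph φ :=
  Summit.HodgeConjecture.HodgeConjecture.Cruxes.HLiu418.K2LiuDoublingLagrangianIsGraph.DoublingLagrangianIsGraph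

/-- socket #12₁ (U3b, Witt half of the orbit lemma) — **`U(J)(L)` acts transitively on totally
isotropic subspaces of equal dimension** (Witt's extension theorem for non-degenerate
`c`-hermitian spaces in characteristic `≠ 2`): for an involutive ring endomorphism `c` of a field `L`
with `2 ≠ 0`, a matrix `J` with `(J.map c)ᵀ = J` and `det J ≠ 0`, and two subspaces `U, U' ≤ L^N`
totally isotropic for `B(x, y) = Σ c(x_i) J_{ij} y_j` with `dim U = dim U'`, some `g` in the tree's
`unitaryGroupOfForm c J ≤ GL_N(L)` (★ `UnitaryGroupAutomorphicRep`) maps `U` onto `U'`. With socket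
#12₀ this gives `P(F) \ U(V^◇)(F) ≅ {Lagrangians}` and the single `G × G`-orbit at `a = 0`; for the
isotropic `V_a` (`a ≥ 2`, road S-A) it is the first input of the general orbit lemma [PSR87 §2].
Mathlib has no Witt theorem (2026-09); this is a genuine M–L file.
[cite: Liu2021, §B.3 p. 101 (P_a = Stab V_a^+)] [cite: PiatetskiShapiroRallis1987, §2] [cite: Scharlau1985, Ch. 7 Thm. 9.1]
audit: paper:liu2021-fourier-jacobi-cycles-arithmetic-relative-trace-formula p0101.txt:L24 «and Va± := V± ⊕ δa± . Let Pa be the parabolic subgroup of U(Va ) stabilizing»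
size M–L · deps: ★ `Literature.NumberTheory.Automorphic.unitaryGroupOfForm`, Mathlib `Matrix.toLin'`, `Submodule.map`,
`Module.finrank` · road S-A and S-B · OWNER: open. -/
theorem sig_K2LiuHermitianWittTransitive :
    ∀ (L : Type) [Field L] (c : L →+* L), (∀ x, c (c x) = x) → (2 : L) ≠ 0 →
      ∀ (N : ℕ) (J : Matrix (Fin N) (Fin N) L), (J.map c)ᵀ = J → J.det ≠ 0 →
        ∀ U U' : Submodule L (Fin N → L),
          (∀ u ∈ U, ∀ v ∈ U, dotProduct (fun i => c (u i)) (J.mulVec v) = 0) →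
            (∀ u ∈ U', ∀ v ∈ U', dotProduct (fun i => c (u i)) (J.mulVec v) = 0) →
              Module.finrank L U = Module.finrank L U' →
                ∃ g ∈ Literature.NumberTheory.Automorphic.unitaryGroupOfForm c J,
                  U.map (Matrix.toLin' (g : Matrix (Fin N) (Fin N) L)) = U' :=
  Summit.HodgeConjecture.HodgeConjecture.Cruxes.HLiu418.K2LiuHermitianWittTransitive

end Summit.HodgeConjecture.HodgeConjecture.Cruxes.HLiu418.K2LiuCurveThetaSigsU3bDoubling
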